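/-
Copyright (c) 2026 the pub-hodgecm-mathlib formalisation cell (harness21).  Prover seat hodgecm-mathlib-K2E1-p02 (g6), Track B ∕ K2-LIT (build stream 29),
h413 = `stmt-HodgeConjecture-24833`, line `K2_E1_TraceFormulaBeta`, campaign «EIS-R7-BL-SPH-2∕3» (Bernstein–Lapid soft continuation), file P6′ §4 = dealer K2E1-plan (g6) deal (18)(b):
the ONE-CALL WIRING of P8 proper's uniqueness letter `hunq` for the CM pair at `N = 2` and `N = 3` (★ P6′ §2 `hunq_of_memLp_two`∕★ P6′₃ `hunq_of_memLp_three` ∘ ★ §3 `hL2_cm_two`∕`hL2_cm_three`).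
-/
import Summits.HodgeConjecture.HodgeConjecture.Theorems.K2E1BLHomogeneousL2U3          -- ★ p859147 (K2E1-p09 g6): `hL2_cm_three` (+ ★ p859128 `hL2_cm_two`, this seat)
import Summits.HodgeConjecture.HodgeConjecture.Theorems.K2E1BLUniquenessSelfAdjointU3   -- ★ p859077 (K2E1-p09 g6): `hunq_of_memLp_three` (+ ★ p859055 `hunq_of_memLp_two`, this seat)
import HarnessLib

/-!
# h413 ∕ Track B «K2-LIT» — file P6′ §4 `K2E1BLUniquenessHunqCM`: P8 PROPER'S UNIQUENESS LETTER `hunq` FOR THE CM PAIR, ONE CALL, AT `N = 2` AND `N = 3`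

Cell `pub/hodgecm-mathlib`, crux H413 = `stmt-HodgeConjecture-24833`, route of record `HCCMUnconditional`; chair K2-lead (g1), dealer K2E1-plan (g6) deal (18)(b) 2026-09-04 («the
`…SelfAdjointU3` §2₃ wiring … is a one-`exact`»).  The «L² + SELF-ADJOINT» uniqueness (★ P6′ §1–§2) composed with item (i) «a homogeneous solution is in `L²(μ)`» (★ P6′ §3 and its
`N = 3` twin ★ `K2E1BLHomogeneousL2U3`) gives the letter `hunq` of ★ P8 §2 `sphericalEisenstein_meromorphicOn_ball_of_letters` (resp. of its `N = 3`, `σ₀ = 2` edition) IN ITS BYTES, from: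
the CM comparison frame `(L μ νG hβ hμZ)` of ★ P2a-ι; ONE symmetric real test function `h i₀` (`Re h ≥ 0`, `h(1) ≠ 0`) with its `𝔛`-side operator `T i₀` of P3-C's shape (`hT`) and
intertwining `hδι` (★ `exists_heckePackage′`), K2's cusp-decay letter `hK1` at `i₀`, the essential bound `hδα₂` (★ §3's payer `exists_ae_norm_deltaShift_le_of_ae_eq_cpow`), and the given
solution `(eX, bX)` (`hsolT hsolC hsolQ`, ★ S-file).  No new mathematics: each head is ONE term.  THEOREMS ONLY (no `def`∕`instance`∕`notation`∕named-fact hypothesis∕`sorry`); lane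
`--kind proof --supports stmt-HodgeConjecture-24833 --as helper` (count-neutral).

* **`hunq_cm_two`** (`N = 2`, `1 < Re z`; `c² = 1` discharged for `c = complexConj L`) and **`hunq_cm_three`** (`N = 3`, `2 < Re z`, `0 < n`).

HONEST LABEL.  Count-neutral helper of the BL-SPH template (consumers: the P8 closers `K2E1SphericalEisensteinMeromorphicU2∕CMThree`); closes no socket; HC_CM is proved only modulo the 7
printed citations (2 remaining named inputs: hLiu418 = `stmt-HodgeConjecture-24832`, h413 = `stmt-HodgeConjecture-24833`) until rung 0 closes.

## References
* [BernsteinLapid2019] J. Bernstein, E. Lapid, *On the meromorphic continuation of Eisenstein series*, J. Amer. Math. Soc. 37 (2024) (arXiv:1911.02342), Thm 2.3, §4 Claims 2, 4, 5.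
* [MoeglinWaldspurger1995] C. Mœglin, J.-L. Waldspurger, *Spectral Decomposition and Eisenstein Series* (1995), IV.1.9–IV.1.10.
-/

set_option autoImplicit false
-- the mandated namespace repeats `HodgeConjecture.HodgeConjecture`, as in every `Theorems/*.lean` of this sub-problem
set_option linter.dupNamespace false

noncomputable section

open MeasureTheory MeasureTheory.Measure Set NumberField IsDedekindDomain Filter Topology Metric
open scoped NNReal ENNReal ComplexConjugate
open Literature.MeasureTheory.Group Literature.NumberTheory.Automorphic Literature.NumberTheory.Automorphic.UnitaryGroup AdelicGroupData
open Summit.HodgeConjecture.HodgeConjecture.Cruxes.H413.K2E1BLBorelSpacesU2Defs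
open Summit.HodgeConjecture.HodgeConjecture.Cruxes.H413.K2E1BLBorelOperatorsU2Defs
open Summit.HodgeConjecture.HodgeConjecture.Cruxes.H413.K2E1BLUniquenessSelfAdjointU2 (hunq_of_memLp_two)
open Summit.HodgeConjecture.HodgeConjecture.Cruxes.H413.K2E1BLUniquenessSelfAdjointU3 (hunq_of_memLp_three)
open Summit.HodgeConjecture.HodgeConjecture.Cruxes.H413.K2E1BLHomogeneousL2U2 (hL2_cm_two)
open Summit.HodgeConjecture.HodgeConjecture.Cruxes.H413.K2E1BLHomogeneousL2U3 (hL2_cm_three)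

namespace Summit.HodgeConjecture.HodgeConjecture.Cruxes.H413.K2E1BLUniquenessHunqCM

variable (L : Type) [Field L] [NumberField L] [IsCMField L]

/-! ## `N = 2` -/

section Two

variable [MeasurableSpace (quasiSplit (↥(maximalRealSubfield L)) L (IsCMField.complexConj L) 2).Adelic]
  [BorelSpace (quasiSplit (↥(maximalRealSubfield L)) L (IsCMField.complexConj L) 2).Adelic]

/-- **P8 PROPER'S `hunq` FOR THE CM PAIR AT `N = 2`, ONE CALL** — the conclusion is the `hunq` letter of ★ `sphericalEisenstein_meromorphicOn_ball_of_letters` byte-for-byte; the proof is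
★ `hunq_of_memLp_two` (self-adjoint `R(h_{i₀})` on `L²(μ)`, `Im ĥ_{i₀} ≠ 0` on `U₀`) fed with ★ `hL2_cm_two` (item (i)); `c² = 1` holds for the CM involution.  Letters left to the closer:
`hT`∕`hδι` (★ `exists_heckePackage′`), `hK1` (K2's cusp decay at `i₀`), `hδα₂` (★ `exists_ae_norm_deltaShift_le_of_ae_eq_cpow`), `hsolT hsolC hsolQ` (★ S-file).
[cite: BernsteinLapid2019, Thm 2.3 and §4 Claim 2 (p. 9)] [cite: MoeglinWaldspurger1995, IV.1.9] -/
theorem hunq_cm_two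
    (μ : Measure (quasiSplit (↥(maximalRealSubfield L)) L (IsCMField.complexConj L) 2).automorphicQuotient)
    [(quasiSplit (↥(maximalRealSubfield L)) L (IsCMField.complexConj L) 2).IsAutomorphicMeasure μ]
    (νG : Measure (quasiSplit (↥(maximalRealSubfield L)) L (IsCMField.complexConj L) 2).Adelic) [νG.IsHaarMeasure] [νG.IsInvInvariant]
    {β : (quasiSplit (↥(maximalRealSubfield L)) L (IsCMField.complexConj L) 2).Adelic → ℝ≥0∞}
    (hβ : IsCoveringWeight ↥((arithmeticBorel (↥(maximalRealSubfield L)) L (IsCMField.complexConj L) 2).map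
      (quasiSplit (↥(maximalRealSubfield L)) L (IsCMField.complexConj L) 2).arithmeticSubgroup.subtype) β)
    {μZ : Measure (borelQuotient (↥(maximalRealSubfield L)) L (IsCMField.complexConj L) 2)}
    (hμZ : ∀ f : borelQuotient (↥(maximalRealSubfield L)) L (IsCMField.complexConj L) 2 → ℝ≥0∞, Measurable f →
      ∫⁻ z, f z ∂μZ = ∫⁻ g, β g * f (toBorelQuotient (↥(maximalRealSubfield L)) L (IsCMField.complexConj L) 2 g) ∂νG)
    (k n : ℕ) {I : Type*} (i₀ : I) {h : I → (quasiSplit (↥(maximalRealSubfield L)) L (IsCMField.complexConj L) 2).Adelic → ℂ}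
    (hhc : ∀ i, Continuous (h i)) (hhs : ∀ i, HasCompactSupport (h i)) (hsymm : ∀ g, h i₀ g⁻¹ = h i₀ g) (hreal : ∀ g, conj (h i₀ g) = h i₀ g)
    (h0 : ∀ g, 0 ≤ (h i₀ g).re) (hh1 : h i₀ 1 ≠ 0)
    {a a₀ : ℝ≥0} (ha₀ : 0 < a₀) (haa₀ : a ≤ a₀) (hfin : μZ {z | a < borelQuotHeight (↥(maximalRealSubfield L)) L (IsCMField.complexConj L) 2 z} ≠ ∞)
    (hb : IotaBound (↥(maximalRealSubfield L)) L (IsCMField.complexConj L) 2 k a μ μZ)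
    (hs : ShiftBound (↥(maximalRealSubfield L)) L (IsCMField.complexConj L) 2 k a a₀ νG μZ (h i₀))
    (T : I → HX (↥(maximalRealSubfield L)) L (IsCMField.complexConj L) 2 k μ →L[ℂ] HX (↥(maximalRealSubfield L)) L (IsCMField.complexConj L) 2 k μ)
    (hT : ∀ u : HX (↥(maximalRealSubfield L)) L (IsCMField.complexConj L) 2 k μ,
      ((T i₀ u : HX (↥(maximalRealSubfield L)) L (IsCMField.complexConj L) 2 k μ) : (quasiSplit (↥(maximalRealSubfield L)) L (IsCMField.complexConj L) 2).automorphicQuotient → ℂ)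
        =ᵐ[μ.withDensity fun x => (((supHeight (↥(maximalRealSubfield L)) L (IsCMField.complexConj L) 2 x)⁻¹ ^ (2 * k) : ℝ≥0) : ℝ≥0∞)]
      fun ξ => ∫ y, h i₀ y * (u : (quasiSplit (↥(maximalRealSubfield L)) L (IsCMField.complexConj L) 2).automorphicQuotient → ℂ) (y⁻¹ • ξ) ∂νG)
    (hδι : deltaShift hs ∘L iota hb = restrHN (↥(maximalRealSubfield L)) L (IsCMField.complexConj L) 2 k haa₀ μZ ∘L iota hb ∘L T i₀)
    {C m : ℝ} (hC : 0 ≤ C) (hm : 0 ≤ m)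
    (hK1 : ∀ f : HNcusp (↥(maximalRealSubfield L)) L (IsCMField.complexConj L) 2 k a μZ,
      ∀ᵐ x ∂(weightedTruncMeasure (↥(maximalRealSubfield L)) L (IsCMField.complexConj L) 2 k a₀ μZ),
        ‖rightConvFun (↥(maximalRealSubfield L)) L (IsCMField.complexConj L) 2 νG (h i₀)
            ((f : HN (↥(maximalRealSubfield L)) L (IsCMField.complexConj L) 2 k a μZ) : borelQuotient (↥(maximalRealSubfield L)) L (IsCMField.complexConj L) 2 → ℂ) x‖ ≤
          C * ‖f‖ * ((borelQuotHeight (↥(maximalRealSubfield L)) L (IsCMField.complexConj L) 2 x : ℝ)) ^ (-m))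
    (α₁ α₂ : ℂ → HN (↥(maximalRealSubfield L)) L (IsCMField.complexConj L) 2 k a μZ)
    (hδα₂ : ∀ z ∈ ball (0 : ℂ) (n + 2), 1 < z.re → ∃ M : ℝ, ∀ᵐ x ∂(weightedTruncMeasure (↥(maximalRealSubfield L)) L (IsCMField.complexConj L) 2 k a₀ μZ),
      ‖(deltaShift hs (α₂ z) : borelQuotient (↥(maximalRealSubfield L)) L (IsCMField.complexConj L) 2 → ℂ) x‖ ≤ M)
    {X' : Type*} [NormedAddCommGroup X'] [NormedSpace ℂ X'] (Q : HX (↥(maximalRealSubfield L)) L (IsCMField.complexConj L) 2 k μ →L[ℂ] X') (φ₀ : ℂ)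
    (eX : ℂ → HX (↥(maximalRealSubfield L)) L (IsCMField.complexConj L) 2 k μ) (bX : ℂ → ℂ)
    (hsolT : ∀ z ∈ ball (0 : ℂ) (n + 2), 1 < z.re → ∀ i, T i (eX z) = (∫ x, h i x * (((borelHeight x : ℝ≥0) : ℝ) : ℂ) ^ z ∂νG) • eX z)
    (hsolC : ∀ z ∈ ball (0 : ℂ) (n + 2), 1 < z.re →
      cnstN (↥(maximalRealSubfield L)) L (IsCMField.complexConj L) 2 k a μZ (iota hb (eX z)) = φ₀ • α₁ z + bX z • α₂ z)
    (hsolQ : ∀ z ∈ ball (0 : ℂ) (n + 2), 1 < z.re → Q (eX z) = 0) :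
    ∃ U₀ : Set ℂ, IsOpen U₀ ∧ U₀.Nonempty ∧ U₀ ⊆ ball (0 : ℂ) (n + 2) ∩ {z : ℂ | 1 < z.re} ∧
      ∀ z ∈ U₀, ∀ (ψ : HX (↥(maximalRealSubfield L)) L (IsCMField.complexConj L) 2 k μ) (b : ℂ),
        (∀ i, T i ψ = (∫ x, h i x * (((borelHeight x : ℝ≥0) : ℝ) : ℂ) ^ z ∂νG) • ψ) →
          cnstN (↥(maximalRealSubfield L)) L (IsCMField.complexConj L) 2 k a μZ (iota hb ψ) = φ₀ • α₁ z + b • α₂ z → Q ψ = 0 → ψ = eX z :=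
  hunq_of_memLp_two (AlgEquiv.ext fun x => by rw [AlgEquiv.mul_apply, AlgEquiv.one_apply, IsCMField.complexConj_apply_apply])
    μ νG k n i₀ hhc hhs hsymm hreal h0 hh1 T hT (iota hb) (cnstN (↥(maximalRealSubfield L)) L (IsCMField.complexConj L) 2 k a μZ) α₁ α₂ Q φ₀ eX bX hsolT hsolC hsolQ
    (hL2_cm_two L μ νG hβ hμZ k n i₀ ha₀ haa₀ hfin hb hs T hδι hC hm hK1 α₂ hδα₂ Q)

end Two

/-! ## `N = 3` -/

section Three

variable [MeasurableSpace (quasiSplit (↥(maximalRealSubfield L)) L (IsCMField.complexConj L) 3).Adelic]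
  [BorelSpace (quasiSplit (↥(maximalRealSubfield L)) L (IsCMField.complexConj L) 3).Adelic]

/-- **P8₃'S `hunq` FOR THE CM PAIR AT `N = 3`, ONE CALL** (`σ₀ = 2`, `0 < n`) — ★ `hunq_of_memLp_three` fed with ★ `hL2_cm_three`; same letters as at `N = 2` (with `2 < Re z`).
[cite: BernsteinLapid2019, Thm 2.3 and §4 Claim 2 (p. 9)] [cite: MoeglinWaldspurger1995, IV.1.9] -/
theorem hunq_cm_three
    (μ : Measure (quasiSplit (↥(maximalRealSubfield L)) L (IsCMField.complexConj L) 3).automorphicQuotient)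
    [(quasiSplit (↥(maximalRealSubfield L)) L (IsCMField.complexConj L) 3).IsAutomorphicMeasure μ]
    (νG : Measure (quasiSplit (↥(maximalRealSubfield L)) L (IsCMField.complexConj L) 3).Adelic) [νG.IsHaarMeasure] [νG.IsInvInvariant]
    {β : (quasiSplit (↥(maximalRealSubfield L)) L (IsCMField.complexConj L) 3).Adelic → ℝ≥0∞}
    (hβ : IsCoveringWeight ↥((arithmeticBorel (↥(maximalRealSubfield L)) L (IsCMField.complexConj L) 3).map
      (quasiSplit (↥(maximalRealSubfield L)) L (IsCMField.complexConj L) 3).arithmeticSubgroup.subtype) β)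
    {μZ : Measure (borelQuotient (↥(maximalRealSubfield L)) L (IsCMField.complexConj L) 3)}
    (hμZ : ∀ f : borelQuotient (↥(maximalRealSubfield L)) L (IsCMField.complexConj L) 3 → ℝ≥0∞, Measurable f →
      ∫⁻ z, f z ∂μZ = ∫⁻ g, β g * f (toBorelQuotient (↥(maximalRealSubfield L)) L (IsCMField.complexConj L) 3 g) ∂νG)
    (k n : ℕ) (hn : 0 < n) {I : Type*} (i₀ : I) {h : I → (quasiSplit (↥(maximalRealSubfield L)) L (IsCMField.complexConj L) 3).Adelic → ℂ}
    (hhc : ∀ i, Continuous (h i)) (hhs : ∀ i, HasCompactSupport (h i)) (hsymm : ∀ g, h i₀ g⁻¹ = h i₀ g) (hreal : ∀ g, conj (h i₀ g) = h i₀ g)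
    (h0 : ∀ g, 0 ≤ (h i₀ g).re) (hh1 : h i₀ 1 ≠ 0)
    {a a₀ : ℝ≥0} (ha₀ : 0 < a₀) (haa₀ : a ≤ a₀) (hfin : μZ {z | a < borelQuotHeight (↥(maximalRealSubfield L)) L (IsCMField.complexConj L) 3 z} ≠ ∞)
    (hb : IotaBound (↥(maximalRealSubfield L)) L (IsCMField.complexConj L) 3 k a μ μZ)
    (hs : ShiftBound (↥(maximalRealSubfield L)) L (IsCMField.complexConj L) 3 k a a₀ νG μZ (h i₀))
    (T : I → HX (↥(maximalRealSubfield L)) L (IsCMField.complexConj L) 3 k μ →L[ℂ] HX (↥(maximalRealSubfield L)) L (IsCMField.complexConj L) 3 k μ)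
    (hT : ∀ u : HX (↥(maximalRealSubfield L)) L (IsCMField.complexConj L) 3 k μ,
      ((T i₀ u : HX (↥(maximalRealSubfield L)) L (IsCMField.complexConj L) 3 k μ) : (quasiSplit (↥(maximalRealSubfield L)) L (IsCMField.complexConj L) 3).automorphicQuotient → ℂ)
        =ᵐ[μ.withDensity fun x => (((supHeight (↥(maximalRealSubfield L)) L (IsCMField.complexConj L) 3 x)⁻¹ ^ (2 * k) : ℝ≥0) : ℝ≥0∞)]
      fun ξ => ∫ y, h i₀ y * (u : (quasiSplit (↥(maximalRealSubfield L)) L (IsCMField.complexConj L) 3).automorphicQuotient → ℂ) (y⁻¹ • ξ) ∂νG)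
    (hδι : deltaShift hs ∘L iota hb = restrHN (↥(maximalRealSubfield L)) L (IsCMField.complexConj L) 3 k haa₀ μZ ∘L iota hb ∘L T i₀)
    {C m : ℝ} (hC : 0 ≤ C) (hm : 0 ≤ m)
    (hK1 : ∀ f : HNcusp (↥(maximalRealSubfield L)) L (IsCMField.complexConj L) 3 k a μZ,
      ∀ᵐ x ∂(weightedTruncMeasure (↥(maximalRealSubfield L)) L (IsCMField.complexConj L) 3 k a₀ μZ),
        ‖rightConvFun (↥(maximalRealSubfield L)) L (IsCMField.complexConj L) 3 νG (h i₀)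
            ((f : HN (↥(maximalRealSubfield L)) L (IsCMField.complexConj L) 3 k a μZ) : borelQuotient (↥(maximalRealSubfield L)) L (IsCMField.complexConj L) 3 → ℂ) x‖ ≤
          C * ‖f‖ * ((borelQuotHeight (↥(maximalRealSubfield L)) L (IsCMField.complexConj L) 3 x : ℝ)) ^ (-m))
    (α₁ α₂ : ℂ → HN (↥(maximalRealSubfield L)) L (IsCMField.complexConj L) 3 k a μZ)
    (hδα₂ : ∀ z ∈ ball (0 : ℂ) (n + 2), 2 < z.re → ∃ M : ℝ, ∀ᵐ x ∂(weightedTruncMeasure (↥(maximalRealSubfield L)) L (IsCMField.complexConj L) 3 k a₀ μZ),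
      ‖(deltaShift hs (α₂ z) : borelQuotient (↥(maximalRealSubfield L)) L (IsCMField.complexConj L) 3 → ℂ) x‖ ≤ M)
    {X' : Type*} [NormedAddCommGroup X'] [NormedSpace ℂ X'] (Q : HX (↥(maximalRealSubfield L)) L (IsCMField.complexConj L) 3 k μ →L[ℂ] X') (φ₀ : ℂ)
    (eX : ℂ → HX (↥(maximalRealSubfield L)) L (IsCMField.complexConj L) 3 k μ) (bX : ℂ → ℂ)
    (hsolT : ∀ z ∈ ball (0 : ℂ) (n + 2), 2 < z.re → ∀ i, T i (eX z) = (∫ x, h i x * (((borelHeight x : ℝ≥0) : ℝ) : ℂ) ^ z ∂νG) • eX z)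
    (hsolC : ∀ z ∈ ball (0 : ℂ) (n + 2), 2 < z.re →
      cnstN (↥(maximalRealSubfield L)) L (IsCMField.complexConj L) 3 k a μZ (iota hb (eX z)) = φ₀ • α₁ z + bX z • α₂ z)
    (hsolQ : ∀ z ∈ ball (0 : ℂ) (n + 2), 2 < z.re → Q (eX z) = 0) :
    ∃ U₀ : Set ℂ, IsOpen U₀ ∧ U₀.Nonempty ∧ U₀ ⊆ ball (0 : ℂ) (n + 2) ∩ {z : ℂ | 2 < z.re} ∧
      ∀ z ∈ U₀, ∀ (ψ : HX (↥(maximalRealSubfield L)) L (IsCMField.complexConj L) 3 k μ) (b : ℂ),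
        (∀ i, T i ψ = (∫ x, h i x * (((borelHeight x : ℝ≥0) : ℝ) : ℂ) ^ z ∂νG) • ψ) →
          cnstN (↥(maximalRealSubfield L)) L (IsCMField.complexConj L) 3 k a μZ (iota hb ψ) = φ₀ • α₁ z + b • α₂ z → Q ψ = 0 → ψ = eX z :=
  hunq_of_memLp_three μ νG k n hn i₀ hhc hhs hsymm hreal h0 hh1 T hT (iota hb) (cnstN (↥(maximalRealSubfield L)) L (IsCMField.complexConj L) 3 k a μZ) α₁ α₂ Q φ₀ eX bX
    hsolT hsolC hsolQ (hL2_cm_three L μ νG hβ hμZ k n i₀ ha₀ haa₀ hfin hb hs T hδι hC hm hK1 α₂ hδα₂ Q)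

end Three

end Summit.HodgeConjecture.HodgeConjecture.Cruxes.H413.K2E1BLUniquenessHunqCM

end
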